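import Summits.KontsevichZagierPeriods.KontsevichZagierPeriods.Theorems.MzvKernelInKZ.Negative.PiLine
import Summits.KontsevichZagierPeriods.KontsevichZagierPeriods.Theorems.TerasomaMultiplicationBetaCancellationStubMoebiusMove
import Literature.NumberTheory.Transcendental.EllIterRepShuffle
import Literature.NumberTheory.Transcendental.GammaMonomialsProofs

/-!
# `HurwitzSectorComplement` (stmt-KontsevichZagierPeriods-14341, route HurwitzMicroSectors),
# line `chebyshev-level-deformation`: stub `stub_arcSimplex` (S2a) — part 1, cyclotomic arcs

One-dimensional moves for the arcs of the Chebyshev ladder, all phrased for GIVEN representations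
`[S, dt/(1+t²)]` of the `t = tan(u/2)`-line (`KZ.IntegralRep 1`):

* `rotate_equivalent`: the arc `(tan β, tan(β+α))` is ONE change of variables (the Möbius rotation
  `t ↦ (cos β · t − sin β)/(sin β · t + cos β)`, `stub_moebiusMove`) away from `(0, tan α)`, for
  `0 ≤ β`, `β + α < π/2`, `cos β`, `sin β` real algebraic;
* `tile_sub_sum_mem_relations`: an arc `(e₀, e_k)` minus the sum of the consecutive cells
  `(eᵢ, eᵢ₊₁)` is a relation (rule (1a) iterated, `KZ.of_sub_sum_of_mem_relations_of_subset`; the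
  cut points are null);
* `arc_nsmul_sub_nsmul_mem_relations`: for `j₀ < j₁`, `2j₁ < L`,
  `L • [(tan(πj₀/L), tan(πj₁/L)), dt/(1+t²)] − 4(j₁−j₀) • [(0,1), dt/(1+t²)] ∈ relations`
  (tile both by the elementary arc of angle `π/(4L)` and rotate every cell onto the first one);
* `halfLine_equivalent`: `[(0,∞), dt/(1+t²)] ∼ [(0,1), 2dt/(1+t²)]` (cut at `t = 1`, fold
  `(1,∞)` onto `(0,1)` by `t ↦ 1/t`, `L1i_cov`; then `Qrep_sub_two_line_mem`). This is conjunct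
  (ii) of the registered stub, restated closed as `arcSimplex_halfLine` (registered sub-goal).

No definitions (pure proof file); the elementary cells are the `lineRep`s of `PiLine.lean`.

References: M. Kontsevich, D. Zagier, *Periods* (2001), §1.2 rules (1)–(2).
-/

noncomputable section

open Set MeasureTheory
open scoped BigOperators
open Literature.NumberTheory.Transcendental
open Literature.ModelTheory.ExponentialFields (IsSemialgebraic)
open Summit.KontsevichZagierPeriods.MzvKernelInKZ.Negative

namespace Summit.KontsevichZagierPeriods.Theorems.HurwitzMicroSectorsHurwitzSectorComplement

namespace ArcSimplex

/-- `tan(πa/b)` is real algebraic (`sin`, `cos` of rational multiples of `π` are). [folklore] -/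
theorem isAlgebraic_tan_rat_mul_pi (a : ℕ) {b : ℕ} (hb : 0 < b) :
    IsAlgebraic ℚ (Real.tan (Real.pi * a / b)) := by
  rw [Real.tan_eq_sin_div_cos, div_eq_mul_inv]
  exact (KoblitzOgus.isAlgebraic_sin_rat_mul_pi a hb).mul
    (KoblitzOgus.isAlgebraic_cos_rat_mul_pi a hb).inv

/-- **Rotation of an arc.** For `0 ≤ β`, `0 < α`, `β + α < π/2` with `cos β`, `sin β` algebraic,
`[(tan β, tan(β + α)), dt/(1+t²)] ∼ [(0, tan α), dt/(1+t²)]`: the Möbius rotation by `−β` of the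
circle `t = tan(angle)` is one rule-(2) move preserving `dt/(1+t²)` (`stub_moebiusMove`), and it
sends `tan β ↦ 0`, `tan(β+α) ↦ tan α`. [cite: KontsevichZagier2001, §1.2 rule (2)] -/
theorem rotate_equivalent {α β : ℝ} (hβ : 0 ≤ β) (hα : 0 < α) (hαβ : β + α < Real.pi / 2)
    (hc : IsAlgebraic ℚ (Real.cos β)) (hs : IsAlgebraic ℚ (Real.sin β))
    (E E₀ : KZ.IntegralRep 1)
    (hE : E.domain = {x | x 0 ∈ Ioo (Real.tan β) (Real.tan (β + α))})
    (hEi : EqOn E.integrand (fun x => 1 / (1 + x 0 ^ 2)) E.domain)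
    (hE₀ : E₀.domain = {x | x 0 ∈ Ioo 0 (Real.tan α)})
    (hE₀i : EqOn E₀.integrand (fun x => 1 / (1 + x 0 ^ 2)) E₀.domain) :
    KZ.Equivalent E E₀ := by
  have hπ := Real.pi_pos
  have hcβ : 0 < Real.cos β := Real.cos_pos_of_mem_Ioo ⟨by linarith, by linarith⟩
  have hcγ : 0 < Real.cos (β + α) := Real.cos_pos_of_mem_Ioo ⟨by linarith, hαβ⟩
  have hsβ : 0 ≤ Real.sin β := Real.sin_nonneg_of_nonneg_of_le_pi hβ (by linarith)
  have hcs : Real.cos β ^ 2 + Real.sin β ^ 2 = 1 := Real.cos_sq_add_sin_sq β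
  have htβ : 0 ≤ Real.tan β := Real.tan_nonneg_of_nonneg_of_le_pi_div_two hβ (by linarith)
  have huv : Real.tan β < Real.tan (β + α) :=
    Real.tan_lt_tan_of_nonneg_of_lt_pi_div_two hβ hαβ (by linarith)
  have hpos : ∀ t ∈ Icc (Real.tan β) (Real.tan (β + α)), 0 < Real.sin β * t + Real.cos β :=
    fun t ht => add_pos_of_nonneg_of_pos (mul_nonneg hsβ (htβ.trans ht.1)) hcβ
  -- the two endpoints of the rotated arc
  have e1 :
      (Real.cos β * Real.tan β - Real.sin β) / (Real.sin β * Real.tan β + Real.cos β) = 0 := by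
    rw [div_eq_zero_iff, mul_comm, Real.tan_mul_cos hcβ.ne', sub_self]
    exact Or.inl rfl
  have k1 : Real.cos β * Real.sin (β + α) - Real.sin β * Real.cos (β + α) = Real.sin α := by
    rw [Real.sin_add, Real.cos_add]; linear_combination Real.sin α * hcs
  have k2 : Real.sin β * Real.sin (β + α) + Real.cos β * Real.cos (β + α) = Real.cos α := by
    rw [Real.sin_add, Real.cos_add]; linear_combination Real.cos α * hcs
  have e2 : (Real.cos β * Real.tan (β + α) - Real.sin β) /
      (Real.sin β * Real.tan (β + α) + Real.cos β) = Real.tan α := by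
    have n1 : Real.cos β * Real.tan (β + α) - Real.sin β = Real.sin α / Real.cos (β + α) := by
      rw [Real.tan_eq_sin_div_cos, eq_div_iff hcγ.ne', ← k1, sub_mul, mul_assoc,
        div_mul_cancel₀ _ hcγ.ne']
    have n2 : Real.sin β * Real.tan (β + α) + Real.cos β = Real.cos α / Real.cos (β + α) := by
      rw [Real.tan_eq_sin_div_cos, eq_div_iff hcγ.ne', ← k2, add_mul, mul_assoc,
        div_mul_cancel₀ _ hcγ.ne']
    rw [n1, n2, div_div_div_cancel_right₀ hcγ.ne', Real.tan_eq_sin_div_cos]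
  refine
    Summit.KontsevichZagierPeriods.KontsevichZagierPeriods.BetaCancellationLine.stub_moebiusMove
      (Real.cos β) (Real.sin β) 1 hc hs isAlgebraic_one hcs (Real.tan β) (Real.tan (β + α)) huv
      hpos E E₀ hE hEi ?_ hE₀i
  rw [e1, e2]; exact hE₀

/-- **Tiling an arc by consecutive cells** (rule (1a) iterated): if `e₀ < e₁ < ⋯ < e_k`, `A` lives
on `(e₀, e_k)` and `Eᵢ` on `(eᵢ, eᵢ₊₁)`, all with the integrand `f`, then `[A] − ∑_{i<k} [Eᵢ]` is a
relation (the cells are disjoint and cover the arc off the null cut points `{eᵢ}`).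
[cite: KontsevichZagier2001, §1.2 rule (1)] -/
theorem tile_sub_sum_mem_relations (k : ℕ) (e : ℕ → ℝ) (he : ∀ i j, i < j → j ≤ k → e i < e j)
    (f : (Fin 1 → ℝ) → ℝ) (A : KZ.IntegralRep 1) (E : ℕ → KZ.IntegralRep 1)
    (hA : A.domain = {x | x 0 ∈ Ioo (e 0) (e k)}) (hAi : EqOn A.integrand f A.domain)
    (hE : ∀ i < k, (E i).domain = {x | x 0 ∈ Ioo (e i) (e (i + 1))})
    (hEi : ∀ i < k, EqOn (E i).integrand f (E i).domain) :
    KZ.of A - ∑ i ∈ Finset.range k, KZ.of (E i) ∈ KZ.relations := by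
  have hmono : ∀ i j, i ≤ j → j ≤ k → e i ≤ e j := fun i j hij hjk => by
    rcases hij.eq_or_lt with h | h
    · rw [h]
    · exact (he i j h hjk).le
  have hsub : ∀ i < k, (E i).domain ⊆ A.domain := fun i hi => by
    rw [hE i hi, hA]
    intro x hx
    exact ⟨(hmono 0 i (Nat.zero_le i) hi.le).trans_lt hx.1,
      hx.2.trans_le (hmono (i + 1) k hi le_rfl)⟩
  refine KZ.of_sub_sum_of_mem_relations_of_subset (Finset.range k) A E
    (fun i hi => hsub i (Finset.mem_range.mp hi)) ?_ ?_ ?_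
  · intro i hi x hx
    have hi' := Finset.mem_range.mp hi
    rw [hEi i hi' hx, hAi (hsub i hi' hx)]
  · refine measure_mono_null (t := ⋃ i : ℕ, {x : Fin 1 → ℝ | x 0 = e i}) ?_
      (measure_iUnion_null fun i => volume_pt1 (e i))
    rintro x ⟨hxA, hxU⟩
    rw [hA] at hxA
    simp only [mem_iUnion, mem_setOf_eq]
    by_contra hne
    push Not at hne
    apply hxU
    classical
    have hex : ∃ i, x 0 ≤ e i := ⟨k, hxA.2.le⟩
    have hfind : x 0 ≤ e (Nat.find hex) := Nat.find_spec hex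
    have h0 : Nat.find hex ≠ 0 := by
      intro h; rw [h] at hfind; exact absurd hxA.1 (not_lt.mpr hfind)
    obtain ⟨i₀, hi₀⟩ := Nat.exists_eq_succ_of_ne_zero h0
    have hlt : e i₀ < x 0 := not_le.mp (Nat.find_min hex (by omega))
    have hle : Nat.find hex ≤ k := Nat.find_le hxA.2.le
    have hi₀k : i₀ < k := by omega
    simp only [mem_iUnion, Finset.mem_range, exists_prop]
    refine ⟨i₀, hi₀k, ?_⟩
    rw [hE i₀ hi₀k]
    refine ⟨hlt, lt_of_le_of_ne ?_ (hne (i₀ + 1))⟩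
    have h' := hfind
    rw [hi₀] at h'
    exact h'
  · have aux : ∀ i j, i < j → j < k → Disjoint (E i).domain (E j).domain := by
      intro i j h hj
      rw [hE i (h.trans hj), hE j hj, Set.disjoint_left]
      rintro x ⟨_, h1⟩ ⟨h2, _⟩
      have : e (i + 1) ≤ e j := hmono (i + 1) j h hj.le
      exact absurd (h1.trans_le this) (not_lt.mpr h2.le)
    intro i hi j hj hij
    rw [Finset.coe_range, mem_Iio] at hi hj
    rcases lt_or_gt_of_ne hij with h | h
    · exact aux i j h hj
    · exact (aux j i h hi).symm

/-- **Arcs versus the unit arc.** For `j₀ < j₁`, `2j₁ < L`, any `A = [(tan(πj₀/L), tan(πj₁/L)),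
dt/(1+t²)]` and `U = [(0,1), dt/(1+t²)]` satisfy `L • [A] − 4(j₁−j₀) • [U] ∈ relations`: with the
elementary angle `π/(4L)`, `A` is tiled by the `4(j₁−j₀)` cells `(tan(iπ/4L), tan((i+1)π/4L))`,
`4j₀ ≤ i < 4j₁`, and `U = (tan 0, tan(π/4))` by the `L` cells `0 ≤ i < L`; every cell is a
rotation of the first one (`rotate_equivalent`; all angles stay below `π/2` since `4j₁ ≤ 2L − 2`).
In angles: `|A| = 2π(j₁−j₀)/L · ½ = 4(j₁−j₀) · π/(4L)` and `|U| = π/4 = L · π/(4L)`.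
[cite: KontsevichZagier2001, §1.2 rules (1)–(2)] -/
theorem arc_nsmul_sub_nsmul_mem_relations (j₀ j₁ L : ℕ) (hj : j₀ < j₁) (hL : 2 * j₁ < L)
    (A U : KZ.IntegralRep 1)
    (hA : A.domain = {x | x 0 ∈ Ioo (Real.tan (Real.pi * j₀ / L)) (Real.tan (Real.pi * j₁ / L))})
    (hAi : EqOn A.integrand (fun x => 1 / (1 + x 0 ^ 2)) A.domain)
    (hU : U.domain = {x | x 0 ∈ Ioo (0:ℝ) 1})
    (hUi : EqOn U.integrand (fun x => 1 / (1 + x 0 ^ 2)) U.domain) :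
    L • KZ.of A - (4 * (j₁ - j₀)) • KZ.of U ∈ KZ.relations := by
  have hπ := Real.pi_pos
  have hL0 : 0 < L := by omega
  have hLr : (L : ℝ) ≠ 0 := by exact_mod_cast hL0.ne'
  have h4L : 0 < 4 * L := by omega
  -- the angles `θ m = π m / (4L)`
  have hθlt : ∀ m : ℕ, m < 2 * L → Real.pi * m / (4 * L) < Real.pi / 2 := fun m hm => by
    have : (m : ℝ) < 2 * L := by exact_mod_cast hm
    rw [div_lt_div_iff₀ (by positivity) two_pos]
    nlinarith
  have hθnn : ∀ m : ℕ, 0 ≤ Real.pi * m / (4 * L) := fun m => by positivity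
  have hθmono : ∀ m m' : ℕ, m < m' → Real.pi * m / (4 * L) < Real.pi * m' / (4 * L) :=
    fun m m' h => div_lt_div_of_pos_right (mul_lt_mul_of_pos_left (by exact_mod_cast h) hπ)
      (by positivity)
  have htan : ∀ m m' : ℕ, m < m' → m' < 2 * L →
      Real.tan (Real.pi * m / (4 * L)) < Real.tan (Real.pi * m' / (4 * L)) := fun m m' h h' =>
    Real.tan_lt_tan_of_nonneg_of_lt_pi_div_two (hθnn m) (hθlt m' h') (hθmono m m' h)
  have halg : ∀ m : ℕ, IsAlgebraic ℚ (Real.tan (Real.pi * m / (4 * L))) := fun m => by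
    have h := isAlgebraic_tan_rat_mul_pi m h4L
    push_cast at h
    exact h
  -- the elementary cells `E m = [(tan θ_m, tan θ_{m+1}), dt/(1+t²)]` and the first one `E₀`
  -- (open intervals with real-algebraic endpoints are `ℚ`-semialgebraic, `EllIterRep`)
  have hsa : ∀ m : ℕ, IsSemialgebraic ℚ {x : Fin 1 → ℝ | x 0 ∈
      Ioo (Real.tan (Real.pi * m / (4 * L))) (Real.tan (Real.pi * (m + 1) / (4 * L)))} := by
    intro m
    have h := (KZ.isSemialgebraic_setOf_const_lt_apply (halg m) (0 : Fin 1)).inter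
      (KZ.isSemialgebraic_setOf_apply_lt_const (halg (m + 1)) (0 : Fin 1))
    push_cast at h
    exact h
  have hsa₀ : IsSemialgebraic ℚ {x : Fin 1 → ℝ | x 0 ∈ Ioo 0 (Real.tan (Real.pi / (4 * L)))} := by
    have h := (KZ.isSemialgebraic_setOf_const_lt_apply (halg 0) (0 : Fin 1)).inter
      (KZ.isSemialgebraic_setOf_apply_lt_const (halg 1) (0 : Fin 1))
    simp only [Nat.cast_zero, mul_zero, zero_div, Real.tan_zero, Nat.cast_one, mul_one] at h
    exact h
  set E : ℕ → KZ.IntegralRep 1 := fun m => lineRep _ (hsa m) with hEdef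
  set E₀ : KZ.IntegralRep 1 := lineRep _ hsa₀ with hE₀def
  have hrot : ∀ m : ℕ, m + 1 < 2 * L → KZ.Equivalent (E m) E₀ := fun m hm => by
    have hc := KoblitzOgus.isAlgebraic_cos_rat_mul_pi m h4L
    have hs := KoblitzOgus.isAlgebraic_sin_rat_mul_pi m h4L
    push_cast at hc hs
    have hadd : Real.pi * m / (4 * L) + Real.pi / (4 * L) = Real.pi * (m + 1) / (4 * L) := by ring
    refine rotate_equivalent (β := Real.pi * m / (4 * L)) (α := Real.pi / (4 * L)) (hθnn m)
      (by positivity) ?_ hc hs (E m) E₀ ?_ (fun _ _ => rfl) rfl (fun _ _ => rfl)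
    · have h := hθlt (m + 1) hm
      push_cast at h
      linarith
    · show {x : Fin 1 → ℝ | x 0 ∈ Ioo (Real.tan (Real.pi * m / (4 * L)))
          (Real.tan (Real.pi * (m + 1) / (4 * L)))} = _
      rw [hadd]
  -- tiling `A` by the cells `4 j₀ ≤ m < 4 j₁`
  have hA' : KZ.of A - (4 * (j₁ - j₀)) • KZ.of E₀ ∈ KZ.relations := by
    set e : ℕ → ℝ := fun i => Real.tan (Real.pi * ((4 * j₀ + i : ℕ) : ℝ) / (4 * L)) with hedef
    have ht := tile_sub_sum_mem_relations (4 * (j₁ - j₀)) e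
      (fun i j hij hjk => htan _ _ (by omega) (by omega)) (fun x => 1 / (1 + x 0 ^ 2)) A
      (fun i => E (4 * j₀ + i)) ?_ hAi ?_ (fun _ _ _ _ => rfl)
    · have hs : ∑ i ∈ Finset.range (4 * (j₁ - j₀)), (KZ.of (E (4 * j₀ + i)) - KZ.of E₀) ∈
          KZ.relations :=
        sum_mem fun i hi => hrot _ (by have := Finset.mem_range.mp hi; omega)
      rw [Finset.sum_sub_distrib, Finset.sum_const, Finset.card_range] at hs
      have := KZ.relations.add_mem ht hs
      rwa [sub_add_sub_cancel] at this
    · rw [hA]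
      have h0 : e 0 = Real.tan (Real.pi * j₀ / L) := by
        simp only [hedef]; congr 1; push_cast; field_simp; ring
      have hk : e (4 * (j₁ - j₀)) = Real.tan (Real.pi * j₁ / L) := by
        simp only [hedef]
        rw [show 4 * j₀ + 4 * (j₁ - j₀) = 4 * j₁ by omega]
        congr 1; push_cast
        rw [mul_left_comm, mul_div_mul_left _ _ (by norm_num : (4:ℝ) ≠ 0)]
      rw [h0, hk]
    · intro i _
      show {x : Fin 1 → ℝ | x 0 ∈ Ioo (Real.tan (Real.pi * ((4 * j₀ + i : ℕ) : ℝ) / (4 * L)))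
          (Real.tan (Real.pi * (((4 * j₀ + i : ℕ) : ℝ) + 1) / (4 * L)))} = _
      simp only [hedef]
      rw [show ((4 * j₀ + (i + 1) : ℕ) : ℝ) = ((4 * j₀ + i : ℕ) : ℝ) + 1 by norm_cast]
  -- tiling `U = (tan 0, tan (π/4))` by the cells `0 ≤ m < L`
  have hU' : KZ.of U - L • KZ.of E₀ ∈ KZ.relations := by
    set e : ℕ → ℝ := fun i => Real.tan (Real.pi * (i : ℝ) / (4 * L)) with hedef
    have ht := tile_sub_sum_mem_relations L e (fun i j hij hjk => htan _ _ hij (by omega))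
      (fun x => 1 / (1 + x 0 ^ 2)) U E ?_ hUi ?_ (fun _ _ _ _ => rfl)
    · have hs : ∑ i ∈ Finset.range L, (KZ.of (E i) - KZ.of E₀) ∈ KZ.relations :=
        sum_mem fun i hi => hrot _ (by have := Finset.mem_range.mp hi; omega)
      rw [Finset.sum_sub_distrib, Finset.sum_const, Finset.card_range] at hs
      have := KZ.relations.add_mem ht hs
      rwa [sub_add_sub_cancel] at this
    · rw [hU]
      have h0 : e 0 = 0 := by simp [hedef]
      have hk : e L = 1 := by
        simp only [hedef]
        rw [mul_div_mul_right _ _ hLr, Real.tan_pi_div_four]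
      rw [h0, hk]
    · intro i _
      show {x : Fin 1 → ℝ | x 0 ∈ Ioo (Real.tan (Real.pi * i / (4 * L)))
          (Real.tan (Real.pi * (i + 1) / (4 * L)))} = _
      simp only [hedef]
      push_cast
      rfl
  -- combine: `L • [A] − 4(j₁−j₀) • [U] = L • ([A] − 4(j₁−j₀) • [E₀]) − 4(j₁−j₀) • ([U] − L • [E₀])`
  have key := KZ.relations.sub_mem (KZ.relations.nsmul_mem hA' L)
    (KZ.relations.nsmul_mem hU' (4 * (j₁ - j₀)))
  rwa [nsmul_sub, nsmul_sub, smul_comm L (4 * (j₁ - j₀)) (KZ.of E₀), sub_sub_sub_cancel_right]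
    at key

/-- **Conjunct (ii) of the stub: the half-line.** `[(0,∞), dt/(1+t²)] ∼ 𝔭₁ = [(0,1), 2dt/(1+t²)]`
for any two representations with these domains and integrands: cut `(0,∞)` at the null point
`t = 1` (rule (1a), `line_peel`), fold `(1,∞)` onto `(0,1)` by `t ↦ 1/t` (rule (2), `L1i_cov`),
and add the two copies of `[(0,1), dt/(1+t²)]` in the integrand (rule (1b),
`Qrep_sub_two_line_mem`). [cite: KontsevichZagier2001, §1.2] -/
theorem halfLine_equivalent (r : KZ.IntegralRep 1) (hr : r.domain = {z | 0 < z 0})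
    (hri : EqOn r.integrand (fun z => 1 / (1 + z 0 ^ 2)) r.domain)
    (s : KZ.IntegralRep 1) (hs : s.domain = {x | ∀ i, x i ∈ Ioo (0:ℝ) 1})
    (hsi : EqOn s.integrand (fun x => ∏ i, 2 / (1 + x i ^ 2)) s.domain) :
    KZ.Equivalent r s := by
  have hT : IsSemialgebraic ℚ {z : Fin 1 → ℝ | 0 < z 0} := by simpa using sa_Ioi1 0
  have h1 : KZ.of r - KZ.of (lineRep _ hT) ∈ KZ.relations :=
    KZ.of_sub_of_mem_relations_of_eqOn hr.symm hri
  have hPT : L01 ⊆ {z : Fin 1 → ℝ | 0 < z 0} := fun x hx => hx.1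
  have h2 := KZ.domainAddRel_subset_relations (line_peel hT sa_L01 hPT)
  have hQ : L1i ⊆ {z : Fin 1 → ℝ | 0 < z 0} \ L01 := fun x hx => by
    have hx' : (1 : ℝ) < x 0 := hx
    exact ⟨show (0 : ℝ) < x 0 by linarith, fun h => by linarith [h.2]⟩
  have h3 := KZ.domainAddRel_subset_relations (line_peel (hT.diff sa_L01) sa_L1i hQ)
  have h4 : KZ.of (lineRep _ ((hT.diff sa_L01).diff sa_L1i)) ∈ KZ.relations := by
    refine KZ.of_mem_relations_of_volume_eq_zero _ (measure_mono_null ?_ (volume_pt1 1))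
    rintro x ⟨⟨hx0, hx1⟩, hx2⟩
    have hx0' : (0 : ℝ) < x 0 := hx0
    have hx1' : ¬ ((0 : ℝ) < x 0 ∧ x 0 < 1) := hx1
    have hx2' : ¬ ((1 : ℝ) < x 0) := hx2
    show x 0 = 1
    push Not at hx1' hx2'
    exact le_antisymm hx2' (hx1' hx0')
  have h5 := KZ.changeOfVariablesRel_subset_relations L1i_cov
  have h6 := Qrep_sub_two_line_mem
  have h7 : KZ.of Qrep - KZ.of s ∈ KZ.relations := by
    refine KZ.of_sub_of_mem_relations_of_eqOn ?_ fun x hx => ?_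
    · rw [hs]; rfl
    · have hx' : x ∈ s.domain := by rw [hs]; exact hx
      rw [hsi hx']
      show gq (x 0) = ∏ i : Fin 1, 2 / (1 + x i ^ 2)
      rw [Fin.prod_univ_one]; rfl
  set R := KZ.of r; set S := KZ.of s; set T := KZ.of (lineRep _ hT)
  set P := KZ.of (lineRep L01 sa_L01); set I := KZ.of (lineRep L1i sa_L1i)
  set TP := KZ.of (lineRep _ (hT.diff sa_L01))
  set TPI := KZ.of (lineRep _ ((hT.diff sa_L01).diff sa_L1i))
  set Q := KZ.of Qrep
  have : R - S =
      (R - T) + (T - P - TP) + (TP - I - TPI) + TPI + (I - P) - (Q - 2 • P) + (Q - S) := by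
    abel
  rw [KZ.Equivalent, this]
  exact add_mem (sub_mem (add_mem (add_mem (add_mem (add_mem h1 h2) h3) h4) h5) h6) h7

end ArcSimplex

/-- **Registered sub-goal of `stub_arcSimplex` (conjunct (ii), the half-line).**
`[(0,∞), dz/(1+z²)] ∼ 𝔭₁ = [(0,1), 2dx/(1+x²)]` for any two representations with these domains and
integrands (`ArcSimplex.halfLine_equivalent`). [cite: KontsevichZagier2001, §1.2] -/
theorem arcSimplex_halfLine :
    ∀ (r : KZ.IntegralRep 1), r.domain = {z | 0 < z 0} →
      Set.EqOn r.integrand (fun z => 1 / (1 + (z 0) ^ 2)) r.domain →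
      ∀ (s : KZ.IntegralRep 1), s.domain = {x | ∀ i, x i ∈ Set.Ioo (0:ℝ) 1} →
        Set.EqOn s.integrand (fun x => ∏ i, 2 / (1 + (x i) ^ 2)) s.domain →
        KZ.Equivalent r s :=
  ArcSimplex.halfLine_equivalent

end Summit.KontsevichZagierPeriods.Theorems.HurwitzMicroSectorsHurwitzSectorComplement
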